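import Summits.QuantumFields.YangMills.Theorems.IR.CollarDecouplingNest

/-!
# Crux `IR` (item stmt-QuantumFields-19354) — line «maximal correlation at one physical thickness»:
THE COLLAR E-SEAM `stub_collarCriterion : CollarCriterion` (registered stub, lead prover ym-ir-line-mxc-p1)

`--supports stmt-QuantumFields-19354` (stub credit for `CollarDecoupling.stub_collarCriterion`; closes no item: the collar
line's load `CollarSharpOnset` / the shell load `IRShellCorr` are open and NOT claimed).

**Statement proved** (`Theorems/IR/ShellMaxCorrDefs.lean` §0, verbatim from ideator ym-ir-idea-5's skeleton
`Cruxes/IR/Lines/collar_decoupling.lean`): `CollarCriterion` — there are `κ > 0` (here `log 2 / 3`) and `s₀` (here `0`) such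
that for every compact `G`, continuous `ρ`, and local gauge-invariant `A, B` there is `C` (here
`4 ‖A‖∞ ‖B‖∞ 2^{R₀(A)+M(B)+1}`) with: collar decoupling at mesh `b ≥ 1` (`CollarDecouplingAt ρ β b`) implies
`|⟨A τ_t B⟩ − ⟨A⟩⟨B⟩| ≤ C exp(−κ t / b)` on every odd torus `2S+1`, `t ≤ S` — constants uniform in `β, b, S`.

**Proof.** §4: `A ∘ torusLift` is cube-local at radius `R₀ = max |coords of supp A|` (`exists_isCubeLocal_torusLift`);
`B ∘ τ_t ∘ torusLift` is exterior-local for every cube `Λ_{R'}(0)` with `R' + M_B < t` (`exists_isExteriorLocal_shift`; the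
0-th coordinate of its base points is at cyclic distance `≥ t − M_B`, `ShellMaxCorr.sub_natAbs_le_natAbs_valMinAbs`).  §5:
`K = ⌊(t − M_B − R₀)/(b+2)⌋` nested collars (`CollarDecouplingNest.sq_corr_le_of_collar`) give
`corr² ≤ 4^{-K} V(f) V(g) ≤ (2^{-K} · 4 C_A C_B)²`; `2^{-K} ≤ 2^{R₀+M_B+1} e^{−(log 2/3) t/b}` (`half_pow_le_exp`, using
`b + 2 ≤ 3b`); the unshifted mean in `latticeConnectedCorr` is handled by translation invariance of the torus state
(`integral_comp_configShift_torusLift`).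

HONEST FRAMING: bookkeeping half of a CONDITIONAL rung line for ONE open gap-crux; the Clay Yang–Mills mass gap is NOT
proved here or by this line; R4 closes only the finite-𝕋⁴ UV rung `BalabanLadder.UV`.
-/

set_option autoImplicit false

noncomputable section

open Filter Topology MeasureTheory ProbabilityTheory
open Literature.MathematicalPhysics.QuantumFieldTheory Literature.MathematicalPhysics.QuantumLattice
open Literature.Probability.LatticeModels (Torus.proj)
open Summit.QuantumFields.YangMills.Cruxes.IR.ShellMaxCorr (sub_natAbs_le_natAbs_valMinAbs abs_integral_le_of_abs_le)

namespace Summit.QuantumFields.YangMills.Cruxes.IR.CollarDecoupling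

/-! ## §4 Supports: the observable in a cube, its time translate outside the cubes -/

section Supports

variable {G : Type} [Group G] [MeasurableSpace G]

/-- **Inner support.**  A local observable read through the periodic lift is cube-local at radius `R₀ = max |coords|` about
the origin, on every odd torus. -/
theorem exists_isCubeLocal_torusLift (A : LocalGaugeObservable 4 G) :
    ∃ R₀ : ℕ, ∀ S : ℕ, IsCubeLocal S 0 R₀ (fun U : GaugeConfig 4 (2 * S + 1) G => A.F (torusLift (2 * S + 1) U)) := by
  classical
  set M : ℕ := A.supp.sup fun e => Finset.univ.sup fun k => (e.1 k).natAbs with hM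
  obtain ⟨CA, hCA⟩ := A.bounded
  refine ⟨M, fun S => ⟨A.measurable.comp (measurable_torusLift (2 * S + 1)), ⟨CA, fun U => hCA _⟩, ?_⟩⟩
  intro U V hUV
  apply A.isCylinder
  intro e he
  refine hUV (torusEdge (2 * S + 1) e) ?_
  simp only [cubeEdges, cubeSites, torusEdge, Set.mem_setOf_eq, Pi.zero_apply, sub_zero]
  intro i
  refine (Literature.MathematicalPhysics.QuantumLattice.natAbs_valMinAbs_intCast_le (L := 2 * S + 1) (e.1 i)).trans ?_
  exact (Finset.le_sup (f := fun k => (e.1 k).natAbs) (Finset.mem_univ i)).trans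
    (Finset.le_sup (f := fun e : Literature.MathematicalPhysics.QuantumLattice.ZdEdge 4 =>
      Finset.univ.sup fun k => (e.1 k).natAbs) he)

/-- **Outer support of the time translate.**  On the torus of side `2S+1`, `B` translated by `t ≤ S` units of Euclidean
time and read through the periodic lift is exterior-local for every cube `Λ_{R'}(0)` with `R' + M_B < t`
(`M_B = max |coords|` over the support of `B`). -/
theorem exists_isExteriorLocal_shift (B : LocalGaugeObservable 4 G) :
    ∃ MB : ℕ, ∀ (S t : ℕ), t ≤ S → ∀ R' : ℕ, R' + MB < t →
      IsExteriorLocal S 0 R' (fun U : GaugeConfig 4 (2 * S + 1) G =>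
        B.F (configShift (-Pi.single 0 (t : ℤ)) (torusLift (2 * S + 1) U))) := by
  classical
  set M : ℕ := B.supp.sup fun e => Finset.univ.sup fun k => (e.1 k).natAbs with hM
  obtain ⟨CB, hCB⟩ := B.bounded
  refine ⟨M, fun S t ht R' hR' => ⟨B.measurable.comp ((configShift _).measurable.comp (measurable_torusLift _)),
    ⟨CB, fun U => hCB _⟩, ?_⟩⟩
  intro U V hUV
  apply B.isCylinder
  intro e he
  rw [configShift_apply, configShift_apply]
  refine hUV (torusEdge (2 * S + 1) (e.1 - -Pi.single 0 (t : ℤ), e.2)) ?_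
  simp only [cubeEdges, cubeSites, torusEdge, Set.mem_compl_iff, Set.mem_setOf_eq, not_forall, not_le]
  refine ⟨0, ?_⟩
  have hx0 : (e.1 0).natAbs ≤ M :=
    (Finset.le_sup (f := fun k => (e.1 k).natAbs) (Finset.mem_univ (0 : Fin 4))).trans
      (Finset.le_sup (f := fun e : Literature.MathematicalPhysics.QuantumLattice.ZdEdge 4 =>
        Finset.univ.sup fun k => (e.1 k).natAbs) he)
  have h := sub_natAbs_le_natAbs_valMinAbs S t ht (e.1 0)
  have hproj : (Torus.proj (2 * S + 1) (e.1 - -Pi.single 0 (t : ℤ))) 0 - (0 : Site 4 (2 * S + 1)) 0 =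
      (((e.1 0 + t : ℤ) : ℤ) : ZMod (2 * S + 1)) := by
    simp only [Torus.proj, sub_neg_eq_add, Pi.add_apply, Pi.single_eq_same, Pi.zero_apply, sub_zero]
  rw [hproj]
  omega

end Supports

/-! ## §5 The registered stub `stub_collarCriterion` -/

section Assembly

/-- Exponent bookkeeping: with `K = ⌊(t − M_B − R₀)/(b+2)⌋` collar steps of mesh `b ≥ 1`,
`2^{-K} ≤ 2^{R₀ + M_B + 1} · exp(−(log 2 / 3) t / b)`. -/
theorem half_pow_le_exp {b t MB R₀ : ℕ} (hb : 1 ≤ b) :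
    (1 / 2 : ℝ) ^ ((t - MB - R₀) / (b + 2)) ≤
      (2 : ℝ) ^ (R₀ + MB + 1) * Real.exp (-(Real.log 2 / 3 * t / b)) := by
  set K : ℕ := (t - MB - R₀) / (b + 2) with hK
  have hlt : t - MB - R₀ < (b + 2) * (K + 1) := Nat.lt_mul_div_succ (t - MB - R₀) (by omega)
  have ht : t ≤ (t - MB - R₀) + MB + R₀ := by omega
  have hnat : t < (b + 2) * (K + 1) + MB + R₀ := by omega
  have hreal : (t : ℝ) ≤ 3 * (b : ℝ) * ((K : ℝ) + R₀ + MB + 1) := by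
    have h1 : (t : ℝ) < ((b : ℝ) + 2) * ((K : ℝ) + 1) + MB + R₀ := by exact_mod_cast hnat
    have hb' : (1 : ℝ) ≤ b := by exact_mod_cast hb
    have hK0 : (0 : ℝ) ≤ K := Nat.cast_nonneg _
    have hM0 : (0 : ℝ) ≤ (MB : ℝ) + R₀ := by positivity
    nlinarith
  have hlog : (0 : ℝ) < Real.log 2 := Real.log_pos (by norm_num)
  have hbpos : (0 : ℝ) < b := by exact_mod_cast (Nat.lt_of_lt_of_le Nat.zero_lt_one hb)
  -- rewrite both sides as exponentials
  have hL : (1 / 2 : ℝ) ^ K = Real.exp (-(K * Real.log 2)) := by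
    rw [Real.exp_neg, Real.exp_nat_mul, Real.exp_log (by norm_num : (0 : ℝ) < 2), one_div, inv_pow]
  have hR : (2 : ℝ) ^ (R₀ + MB + 1) = Real.exp (((R₀ + MB + 1 : ℕ) : ℝ) * Real.log 2) := by
    rw [Real.exp_nat_mul, Real.exp_log (by norm_num : (0 : ℝ) < 2)]
  rw [hL, hR, ← Real.exp_add]
  refine Real.exp_le_exp.2 ?_
  have hdiv : Real.log 2 / 3 * t / b ≤ Real.log 2 * ((K : ℝ) + R₀ + MB + 1) := by
    rw [div_le_iff₀ hbpos]
    have := mul_le_mul_of_nonneg_left hreal hlog.le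
    nlinarith
  push_cast
  nlinarith

variable {G : Type} [Group G] [TopologicalSpace G] [IsTopologicalGroup G] [CompactSpace G]

/-- **E-SEAM of the collar line (registered stub `stub_collarCriterion` of the merged line «maximal correlation at one
physical thickness», crux `IR` = stmt-QuantumFields-19354).**  Collar decoupling at mesh `b ≥ 1`
(`CollarDecouplingAt ρ β b`: every cube-local statistic has a Markov-local surrogate, orthogonal-equivalent against the
exterior of the collar and of at most a quarter of the variance) implies exponential clustering of the connected time
correlations of all local gauge-invariant observables on every odd torus, at rate `κ/b` with `κ = log 2 / 3`, `s₀ = 0`,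
and `C(A,B) = 4 ‖A‖∞ ‖B‖∞ 2^{R₀(A) + M(B) + 1}` uniform in `β, b, S`: nest `⌊(t − M_B − R₀)/(b+2)⌋` collars around the
support cube of `A` (`sq_corr_le_of_collar`), close with Cauchy–Schwarz; the time translate of `B` is exterior to all of
them (`exists_isExteriorLocal_shift`), and translation invariance of the torus state handles the unshifted mean.  No
Yang–Mills input beyond the format.  HONEST FRAMING: bookkeeping half of a CONDITIONAL rung line; the load
(`CollarSharpOnset` / `IRShellCorr`) is open and NOT claimed; no mass-gap claim. -/
theorem stub_collarCriterion : CollarCriterion := by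
  refine ⟨Real.log 2 / 3, 0, by positivity, ?_⟩
  intro G _ _ _ _ _ _ n ρ hρ A B
  obtain ⟨R₀, hA⟩ := exists_isCubeLocal_torusLift A
  obtain ⟨MB, hB⟩ := exists_isExteriorLocal_shift B
  obtain ⟨CA, hCA⟩ := A.bounded
  obtain ⟨CB, hCB⟩ := B.bounded
  have hCA0 : 0 ≤ CA := (abs_nonneg _).trans (hCA (fun _ => 1))
  have hCB0 : 0 ≤ CB := (abs_nonneg _).trans (hCB (fun _ => 1))
  refine ⟨4 * CA * CB * 2 ^ (R₀ + MB + 1), fun β b hb hP S _ t ht => ?_⟩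
  haveI : IsProbabilityMeasure (wilsonMeasure (d := 4) (L := 2 * S + 1) ρ β) :=
    isProbabilityMeasure_wilsonMeasure (d := 4) (L := 2 * S + 1) ρ hρ β
  have hfm : Measurable (fun U : GaugeConfig 4 (2 * S + 1) G => A.F (torusLift (2 * S + 1) U)) :=
    A.measurable.comp (measurable_torusLift (2 * S + 1))
  have hgm : Measurable (fun U : GaugeConfig 4 (2 * S + 1) G =>
      B.F (configShift (-Pi.single 0 (t : ℤ)) (torusLift (2 * S + 1) U))) :=
    B.measurable.comp ((configShift _).measurable.comp (measurable_torusLift _))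
  have hfC : ∀ U : GaugeConfig 4 (2 * S + 1) G, |A.F (torusLift (2 * S + 1) U)| ≤ CA := fun U => hCA _
  have hgC : ∀ U : GaugeConfig 4 (2 * S + 1) G,
      |B.F (configShift (-Pi.single 0 (t : ℤ)) (torusLift (2 * S + 1) U))| ≤ CB := fun U => hCB _
  set K : ℕ := (t - MB - R₀) / (b + 2) with hK
  have hKle : K * (b + 2) ≤ t - MB - R₀ := Nat.div_mul_le_self _ _
  have key := sq_corr_le_of_collar ρ hρ β hP S hgm hgC ht (hB S t ht) K R₀ _ (hA S) hKle
  have hVf := var_le_sq (wilsonMeasure (d := 4) (L := 2 * S + 1) ρ β) hfC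
  have hVg := var_le_sq (wilsonMeasure (d := 4) (L := 2 * S + 1) ρ β) hgC
  have hVf0 : 0 ≤ ∫ U, (A.F (torusLift (2 * S + 1) U) -
      ∫ W, A.F (torusLift (2 * S + 1) W) ∂(wilsonMeasure (d := 4) (L := 2 * S + 1) ρ β)) ^ 2
      ∂(wilsonMeasure (d := 4) (L := 2 * S + 1) ρ β) := integral_nonneg fun U => sq_nonneg _
  have hq : 0 ≤ (1 / 4 : ℝ) ^ K := pow_nonneg (by norm_num) _
  -- `corr² ≤ ((1/2)^K · 4 C_A C_B)²`
  have hsq : ((∫ U, A.F (torusLift (2 * S + 1) U) *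
        B.F (configShift (-Pi.single 0 (t : ℤ)) (torusLift (2 * S + 1) U))
          ∂(wilsonMeasure (d := 4) (L := 2 * S + 1) ρ β)) -
      (∫ U, A.F (torusLift (2 * S + 1) U) ∂(wilsonMeasure (d := 4) (L := 2 * S + 1) ρ β)) *
        (∫ U, B.F (configShift (-Pi.single 0 (t : ℤ)) (torusLift (2 * S + 1) U))
          ∂(wilsonMeasure (d := 4) (L := 2 * S + 1) ρ β))) ^ 2 ≤
      ((1 / 2 : ℝ) ^ K * (4 * CA * CB)) ^ 2 := by
    refine key.trans ?_
    have e : ((1 / 2 : ℝ) ^ K * (4 * CA * CB)) ^ 2 = (1 / 4 : ℝ) ^ K * ((2 * CA) ^ 2 * (2 * CB) ^ 2) := by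
      rw [mul_pow, ← pow_mul, mul_comm K 2, pow_mul]; norm_num; ring
    rw [e, mul_assoc]
    exact mul_le_mul_of_nonneg_left (mul_le_mul hVf hVg (integral_nonneg fun U => sq_nonneg _)
      (by positivity)) hq
  have habs := abs_le_of_sq_le_sq hsq (by positivity)
  unfold latticeConnectedCorr
  rw [← integral_comp_configShift_torusLift ρ β B.F (-Pi.single 0 (t : ℤ))]
  refine habs.trans ?_
  have hexp := half_pow_le_exp (t := t) (MB := MB) (R₀ := R₀) hb
  calc (1 / 2 : ℝ) ^ K * (4 * CA * CB) = (4 * CA * CB) * (1 / 2 : ℝ) ^ K := by ring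
    _ ≤ (4 * CA * CB) * ((2 : ℝ) ^ (R₀ + MB + 1) * Real.exp (-(Real.log 2 / 3 * t / b))) :=
        mul_le_mul_of_nonneg_left hexp (by positivity)
    _ = 4 * CA * CB * 2 ^ (R₀ + MB + 1) * Real.exp (-(Real.log 2 / 3 * t / b)) := by ring

end Assembly

end Summit.QuantumFields.YangMills.Cruxes.IR.CollarDecoupling

end
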